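import Summits.Ventures.YMGap.Thresholds.CumulantRecursion
import HarnessLib

/-!
# Venture YMGap — calculus of the anchored cumulants (chain rule, series, the fresh-slot identity) and the
# measure-level vocabulary of the truncated functions (`slots`, `mom`, `trunc`)

HONEST FRAMING: venture file of the cell `pub-ymgap` (QuantumFields programme), seat ds-1 (gen 12).  Pure finite
combinatorics / probability bookkeeping — no lattice, no number, nothing about the continuum or the Clay problem.
Second half of the algebra layer of the object «C-SMOOTH» (sibling `CumulantRecursion`: the recursion `ac`, bounds, the
split lemma; lattice files `TruncatedTreeDecay`, `CouplingSmooth`).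

* `dac m m' a T` — the linearisation of `ac · a T` at the moment function `m` in the direction `m'` (Leibniz rule on
  the recursion); `hasDerivAt_ac` — chain rule: moments differentiable in a parameter ⇒ so is the anchored cumulant,
  with derivative `dac` (`continuousOn_ac`: continuity likewise); `dac_const_mul`, `dac_tsum` — `dac` is linear in `m'`,
  also through absolutely convergent series;
* ★ `dac_eq_ac_insert` — THE FRESH-SLOT IDENTITY: if `M` extends `m` by a new slot `s` and the direction is the
  covariance with the new slot, `m' T = M (T ∪ {s}) − m T · M {s}`, then `dac m m' a T = ac M a (T ∪ {s})` — the
  derivative of the `n`-th truncated function along a tilt with source `X_s` is the `(n+1)`-st truncated function;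
* `slots F W q` (slot `0` carries `F`, slot `i + 1` carries `W (q i)`), `slots_snoc_of_le` / `slots_snoc_last`
  (appending a source does not move the old slots), `mom μ X T = ∫ ∏_{i∈T} X_i dμ`, `abs_mom_le`, `mom_congr`,
  `trunc μ F W q = ac (mom μ (slots F W q)) 0 (range (n+1))` = the connected `(n+1)`-point function
  `u_{n+1}(F; W_{q 0}; …; W_{q (n−1)})`, `trunc_fin_zero` (`u_1(F) = ⟨F⟩`);
* `summable_pi_of_abs_le_prod` — a product bound `|f q| ≤ A ∏_i g (q i)` is summable over tuples `q : Fin n → P`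
  with `Σ' |f| ≤ A Zⁿ`.

References (mechanism only): B. Simon, *The Statistical Mechanics of Lattice Gases* I (1993), §II.12;
T. P. Speed, Austral. J. Statist. 25 (1983) 378.
-/

noncomputable section

open Finset MeasureTheory Filter Topology

namespace Summit.Ventures.YMGap.Cumulants

variable {ι : Type*} [DecidableEq ι]

/-! ### §4 Calculus: the linearised recursion, the chain rule, series, and the fresh-slot identity -/

/-- **The linearisation of `ac` at `m` in the direction `m'`** (same recursion, Leibniz rule on each product):
`dac m m' a T = m' T − Σ_{B ∈ apsub a T} (dac m m' a B · m (T \ B) + ac m a B · m' (T \ B))`. -/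
def dac (m m' : Finset ι → ℝ) (a : ι) (T : Finset ι) : ℝ :=
  m' T - ∑ B ∈ (apsub a T).attach, (dac m m' a B.1 * m (T \ B.1) + ac m a B.1 * m' (T \ B.1))
termination_by T.card
decreasing_by exact card_lt_of_mem_apsub B.2

/-- The defining recursion of `dac`, with a plain `Finset.sum`. -/
theorem dac_eq (m m' : Finset ι → ℝ) (a : ι) (T : Finset ι) :
    dac m m' a T = m' T - ∑ B ∈ apsub a T, (dac m m' a B * m (T \ B) + ac m a B * m' (T \ B)) := by
  rw [dac, Finset.sum_attach (apsub a T) (fun B => dac m m' a B * m (T \ B) + ac m a B * m' (T \ B))]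

/-- **Chain rule**: if every moment `t ↦ m t T`, `T ⊆ S`, has derivative `m' T` at `t₀`, then
`t ↦ ac (m t) a T` has derivative `dac (m t₀) m' a T` at `t₀`. [folklore] -/
theorem hasDerivAt_ac {m : ℝ → Finset ι → ℝ} {m' : Finset ι → ℝ} {S : Finset ι} {t₀ : ℝ}
    (h : ∀ T ⊆ S, HasDerivAt (fun t => m t T) (m' T) t₀) (a : ι) :
    ∀ T ⊆ S, HasDerivAt (fun t => ac (m t) a T) (dac (m t₀) m' a T) t₀ := by
  intro T
  induction T using Finset.strongInduction with
  | H T ih =>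
    intro hTS
    have hfun : (fun t => ac (m t) a T) = fun t => m t T - ∑ B ∈ apsub a T, ac (m t) a B * m t (T \ B) := by
      funext t; exact ac_eq _ _ _
    rw [hfun, dac_eq]
    refine (h T hTS).sub (HasDerivAt.fun_sum fun B hB => ?_)
    have hB' := mem_apsub.1 hB
    exact (ih B (ssubset_of_mem_apsub hB) (hB'.1.trans hTS)).fun_mul (h (T \ B) (Finset.sdiff_subset.trans hTS))

/-- **Continuity**: if every moment `x ↦ m x T`, `T ⊆ S`, is continuous on `s`, so is `x ↦ ac (m x) a T`. [folklore] -/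
theorem continuousOn_ac {Y : Type*} [TopologicalSpace Y] {m : Y → Finset ι → ℝ} {S : Finset ι} {s : Set Y}
    (h : ∀ T ⊆ S, ContinuousOn (fun x => m x T) s) (a : ι) :
    ∀ T ⊆ S, ContinuousOn (fun x => ac (m x) a T) s := by
  intro T
  induction T using Finset.strongInduction with
  | H T ih =>
    intro hTS
    have hfun : (fun x => ac (m x) a T) = fun x => m x T - ∑ B ∈ apsub a T, ac (m x) a B * m x (T \ B) := by
      funext x; exact ac_eq _ _ _
    rw [hfun]
    refine (h T hTS).sub (continuousOn_finsetSum _ fun B hB => ?_)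
    have hB' := mem_apsub.1 hB
    exact (ih B (ssubset_of_mem_apsub hB) (hB'.1.trans hTS)).mul (h (T \ B) (Finset.sdiff_subset.trans hTS))

/-- **Homogeneity of `dac` in the direction**: `dac m (c·m') a T = c · dac m m' a T`. [folklore] -/
theorem dac_const_mul {m m' : Finset ι → ℝ} (c : ℝ) (a : ι) :
    ∀ T : Finset ι, dac m (fun T => c * m' T) a T = c * dac m m' a T := by
  intro T
  induction T using Finset.strongInduction with
  | H T ih =>
    rw [dac_eq, dac_eq, mul_sub, Finset.mul_sum]
    congr 1
    refine Finset.sum_congr rfl fun B hB => ?_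
    rw [ih B (ssubset_of_mem_apsub hB)]
    ring

/-- **Linearity of `dac` through absolutely convergent series**: if each `r ↦ m' r T`, `T ⊆ S`, is summable, then
`r ↦ dac m (m' r) a T` is summable and `Σ'_r dac m (m' r) a T = dac m (T ↦ Σ'_r m' r T) a T`. [folklore] -/
theorem dac_tsum {γ : Type*} {m : Finset ι → ℝ} {m' : γ → Finset ι → ℝ} {S : Finset ι}
    (hs : ∀ T ⊆ S, Summable fun r => m' r T) (a : ι) :
    ∀ T ⊆ S, Summable (fun r => dac m (m' r) a T) ∧
      ∑' r, dac m (m' r) a T = dac m (fun T => ∑' r, m' r T) a T := by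
  intro T
  induction T using Finset.strongInduction with
  | H T ih =>
    intro hTS
    have hfun : (fun r => dac m (m' r) a T) =
        fun r => m' r T - ∑ B ∈ apsub a T, (dac m (m' r) a B * m (T \ B) + ac m a B * m' r (T \ B)) := by
      funext r; exact dac_eq _ _ _ _
    have hB : ∀ B ∈ apsub a T, Summable (fun r => dac m (m' r) a B * m (T \ B) + ac m a B * m' r (T \ B)) ∧
        ∑' r, (dac m (m' r) a B * m (T \ B) + ac m a B * m' r (T \ B)) =
          dac m (fun T => ∑' r, m' r T) a B * m (T \ B) + ac m a B * ∑' r, m' r (T \ B) := by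
      intro B hB
      have hB' := mem_apsub.1 hB
      obtain ⟨s1, e1⟩ := ih B (ssubset_of_mem_apsub hB) (hB'.1.trans hTS)
      have s2 := hs (T \ B) (Finset.sdiff_subset.trans hTS)
      refine ⟨(s1.mul_right _).add (s2.mul_left _), ?_⟩
      rw [(s1.mul_right _).tsum_add (s2.mul_left _), tsum_mul_right, tsum_mul_left, e1]
    have hsum : Summable fun r => ∑ B ∈ apsub a T, (dac m (m' r) a B * m (T \ B) + ac m a B * m' r (T \ B)) :=
      summable_sum fun B hB' => (hB B hB').1
    rw [hfun, dac_eq]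
    refine ⟨(hs T hTS).sub hsum, ?_⟩
    rw [(hs T hTS).tsum_sub hsum, Summable.tsum_finsetSum fun B hB' => (hB B hB').1]
    congr 1
    exact Finset.sum_congr rfl fun B hB' => (hB B hB').2

/-- ★ **THE FRESH-SLOT IDENTITY**: let `s ∉ S`, let `M` extend `m` (`M T = m T` for `T ⊆ S`) and let the direction be
the «covariance with the new slot», `m' T = M (insert s T) − m T · M {s}` for `T ⊆ S`.  Then for every `T ⊆ S`
containing the anchor, `dac m m' a T = ac M a (insert s T)` — differentiating the `n`-th truncated function along a
tilt produces the `(n+1)`-st. [folklore] -/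
theorem dac_eq_ac_insert {m m' M : Finset ι → ℝ} {S : Finset ι} {s a : ι} (hs : s ∉ S)
    (hMm : ∀ T ⊆ S, M T = m T) (hm' : ∀ T ⊆ S, m' T = M (insert s T) - m T * M {s}) :
    ∀ T ⊆ S, a ∈ T → dac m m' a T = ac M a (insert s T) := by
  intro T
  induction T using Finset.strongInduction with
  | H T ih =>
    intro hTS haT
    have hsT : s ∉ T := fun h => hs (hTS h)
    have has : a ≠ s := fun h => hsT (h ▸ haT)
    -- split the recursion for `insert s T` according to `s ∈ B'`
    rw [dac_eq, ac_eq, ← Finset.sum_filter_add_sum_filter_not (apsub a (insert s T)) (fun B => s ∈ B)]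
    -- blocks containing `s`: `B' = insert s B`, `B ∈ apsub a T`
    have hwith : (apsub a (insert s T)).filter (fun B => s ∈ B) = (apsub a T).image (insert s) := by
      ext B'
      simp only [Finset.mem_filter, Finset.mem_image, mem_apsub]
      constructor
      · rintro ⟨⟨hB'T, haB', hne⟩, hsB'⟩
        refine ⟨B'.erase s, ⟨?_, ?_, ?_⟩, Finset.insert_erase hsB'⟩
        · intro i hi
          obtain ⟨his, hiB'⟩ := Finset.mem_erase.1 hi
          exact (Finset.mem_insert.1 (hB'T hiB')).resolve_left his
        · exact Finset.mem_erase.2 ⟨has, haB'⟩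
        · intro h
          exact hne (by rw [← Finset.insert_erase hsB', h])
      · rintro ⟨B, ⟨hBT, haB, hne⟩, rfl⟩
        refine ⟨⟨Finset.insert_subset_insert s hBT, Finset.mem_insert_of_mem haB, fun h => hne ?_⟩,
          Finset.mem_insert_self s B⟩
        have hsB : s ∉ B := fun h' => hsT (hBT h')
        rw [← Finset.erase_insert hsB, h, Finset.erase_insert hsT]
    -- blocks avoiding `s`: all anchored subsets of `T`, including `T` itself
    have hwithout : (apsub a (insert s T)).filter (fun B => ¬s ∈ B) = insert T (apsub a T) := by
      ext B'
      simp only [Finset.mem_filter, Finset.mem_insert, mem_apsub]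
      constructor
      · rintro ⟨⟨hB'T, haB', -⟩, hsB'⟩
        have hB'T' : B' ⊆ T := fun i hi => (Finset.mem_insert.1 (hB'T hi)).resolve_left (fun h => hsB' (h ▸ hi))
        by_cases h : B' = T
        · exact Or.inl h
        · exact Or.inr ⟨hB'T', haB', h⟩
      · rintro (rfl | ⟨hB'T, haB', -⟩)
        · exact ⟨⟨Finset.subset_insert s _, haT, fun h => hsT (h ▸ Finset.mem_insert_self s _)⟩, hsT⟩
        · exact ⟨⟨hB'T.trans (Finset.subset_insert s T), haB',
            fun h => hsT (hB'T (h ▸ Finset.mem_insert_self s T))⟩, fun h => hsT (hB'T h)⟩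
    have hinj : Set.InjOn (fun B : Finset ι => insert s B) ((apsub a T : Finset (Finset ι)) : Set (Finset ι)) := by
      intro B₁ h₁ B₂ h₂ h
      have hs₁ : s ∉ B₁ := fun h' => hsT ((mem_apsub.1 h₁).1 h')
      have hs₂ : s ∉ B₂ := fun h' => hsT ((mem_apsub.1 h₂).1 h')
      have h' : insert s B₁ = insert s B₂ := h
      rw [← Finset.erase_insert hs₁, h', Finset.erase_insert hs₂]
    have hT : T ∉ apsub a T := fun h => (mem_apsub.1 h).2.2 rfl
    rw [hwith, Finset.sum_image hinj, hwithout, Finset.sum_insert hT]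
    -- evaluate the three groups of terms
    have e1 : ∀ B ∈ apsub a T, ac M a (insert s B) * M (insert s T \ insert s B) = dac m m' a B * m (T \ B) := by
      intro B hB
      have hB' := mem_apsub.1 hB
      have hsB : s ∉ B := fun h => hsT (hB'.1 h)
      have e : insert s T \ insert s B = T \ B := by
        ext i
        simp only [Finset.mem_sdiff, Finset.mem_insert]
        constructor
        · rintro ⟨h | h, hn⟩
          · exact absurd (Or.inl h) hn
          · exact ⟨h, fun h' => hn (Or.inr h')⟩
        · rintro ⟨hiT, hiB⟩
          exact ⟨Or.inr hiT, fun h => h.elim (fun h' => hsT (h' ▸ hiT)) hiB⟩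
      rw [ih B (ssubset_of_mem_apsub hB) (hB'.1.trans hTS) hB'.2.1, e, hMm _ (Finset.sdiff_subset.trans hTS)]
    have e2 : ∀ B ∈ apsub a T, ac M a B * M (insert s T \ B) = ac m a B * M (insert s (T \ B)) := by
      intro B hB
      have hB' := mem_apsub.1 hB
      have hsB : s ∉ B := fun h => hsT (hB'.1 h)
      rw [ac_congr a (S := S) hMm B (hB'.1.trans hTS), Finset.insert_sdiff_of_notMem _ hsB]
    have e3 : ac M a T * M (insert s T \ T) = ac m a T * M {s} := by
      rw [ac_congr a (S := S) hMm T hTS, Finset.insert_sdiff_of_notMem _ hsT, Finset.sdiff_self]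
      rfl
    have e4 : ∀ B ∈ apsub a T, m' (T \ B) = M (insert s (T \ B)) - m (T \ B) * M {s} := fun B hB =>
      hm' _ (Finset.sdiff_subset.trans hTS)
    rw [Finset.sum_congr rfl e1, Finset.sum_congr rfl e2, e3, hm' T hTS]
    have e5 : ∑ B ∈ apsub a T, (dac m m' a B * m (T \ B) + ac m a B * m' (T \ B)) =
        ∑ B ∈ apsub a T, dac m m' a B * m (T \ B) + ∑ B ∈ apsub a T, ac m a B * M (insert s (T \ B))
          - M {s} * ∑ B ∈ apsub a T, ac m a B * m (T \ B) := by
      rw [Finset.mul_sum, ← Finset.sum_add_distrib, ← Finset.sum_sub_distrib]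
      refine Finset.sum_congr rfl fun B hB => ?_
      rw [e4 B hB]
      ring
    rw [e5]
    have key := ac_eq m a T
    linear_combination (M {s}) * key

/-! ### §5 Generic measure-level vocabulary: slots, moments, truncated functions; product summability -/

section Slots

variable {Ω P : Type*}

/-- **The slot family** of the truncated functions: slot `0` carries the observable `F`, slot `i + 1` (`i < n`)
carries `W (q i)`, the remaining slots carry the harmless constant `1` (never used: all index sets live in
`range (n+1)`). -/
def slots (F : Ω → ℝ) (W : P → Ω → ℝ) {n : ℕ} (q : Fin n → P) : ℕ → Ω → ℝ
  | 0 => F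
  | i + 1 => if h : i < n then W (q ⟨i, h⟩) else fun _ => 1

omit [DecidableEq ι] in
/-- Slot `0` is `F`. -/
@[simp] theorem slots_zero (F : Ω → ℝ) (W : P → Ω → ℝ) {n : ℕ} (q : Fin n → P) : slots F W q 0 = F := rfl

omit [DecidableEq ι] in
/-- Slot `i + 1` is `W (q i)` for `i < n`. -/
theorem slots_succ_of_lt (F : Ω → ℝ) (W : P → Ω → ℝ) {n : ℕ} (q : Fin n → P) {i : ℕ} (h : i < n) :
    slots F W q (i + 1) = W (q ⟨i, h⟩) := by
  simp [slots, h]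

omit [DecidableEq ι] in
/-- Slots beyond `n` are the constant `1`. -/
theorem slots_succ_of_le (F : Ω → ℝ) (W : P → Ω → ℝ) {n : ℕ} (q : Fin n → P) {i : ℕ} (h : n ≤ i) :
    slots F W q (i + 1) = fun _ => 1 := by
  simp [slots, not_lt.2 h]

omit [DecidableEq ι] in
/-- **Appending a plaquette does not move the old slots**: `slots F W (Fin.snoc q r) i = slots F W q i` for
`i ≤ n`. -/
theorem slots_snoc_of_le (F : Ω → ℝ) (W : P → Ω → ℝ) {n : ℕ} (q : Fin n → P) (r : P) {i : ℕ} (hi : i ≤ n) :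
    slots F W (Fin.snoc q r : Fin (n + 1) → P) i = slots F W q i := by
  cases i with
  | zero => rfl
  | succ j =>
    have hj : j < n := hi
    rw [slots_succ_of_lt F W _ (Nat.lt_succ_of_lt hj), slots_succ_of_lt F W q hj]
    have e : (⟨j, Nat.lt_succ_of_lt hj⟩ : Fin (n + 1)) = Fin.castSucc ⟨j, hj⟩ := rfl
    rw [e, Fin.snoc_castSucc]

omit [DecidableEq ι] in
/-- **The appended plaquette sits in slot `n + 1`**: `slots F W (Fin.snoc q r) (n + 1) = W r`. -/
theorem slots_snoc_last (F : Ω → ℝ) (W : P → Ω → ℝ) {n : ℕ} (q : Fin n → P) (r : P) :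
    slots F W (Fin.snoc q r : Fin (n + 1) → P) (n + 1) = W r := by
  rw [slots_succ_of_lt F W _ (Nat.lt_succ_self n)]
  have e : (⟨n, Nat.lt_succ_self n⟩ : Fin (n + 1)) = Fin.last n := rfl
  rw [e, Fin.snoc_last]

variable [MeasurableSpace Ω]

/-- **Moments** of a slot family: `mom μ X T = ∫ ∏_{i ∈ T} X_i dμ`. -/
def mom (μ : Measure Ω) (X : ℕ → Ω → ℝ) (T : Finset ℕ) : ℝ := ∫ ω, ∏ i ∈ T, X i ω ∂μ

/-- **The truncated (connected) `(n+1)`-point function** `u_{n+1}(F; W_{q 0}; …; W_{q (n-1)})` under `μ`: the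
anchored cumulant (anchor = the slot of `F`) of the moments of the slot family on `range (n+1)`. -/
def trunc (μ : Measure Ω) (F : Ω → ℝ) (W : P → Ω → ℝ) {n : ℕ} (q : Fin n → P) : ℝ :=
  ac (mom μ (slots F W q)) 0 (Finset.range (n + 1))

omit [DecidableEq ι] in
/-- Under a probability measure the empty moment is `1`. -/
theorem mom_empty (μ : Measure Ω) [IsProbabilityMeasure μ] (X : ℕ → Ω → ℝ) : mom μ X ∅ = 1 := by
  simp [mom]

omit [DecidableEq ι] in
/-- **Moments of bounded slots are bounded by the product of the bounds** (probability measure; no measurability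
needed). -/
theorem abs_mom_le (μ : Measure Ω) [IsProbabilityMeasure μ] {X : ℕ → Ω → ℝ} {b : ℕ → ℝ} {S : Finset ℕ}
    (hb : ∀ i ∈ S, ∀ ω, |X i ω| ≤ b i) : ∀ T ⊆ S, |mom μ X T| ≤ ∏ i ∈ T, b i := by
  intro T hTS
  have hpt : ∀ ω, |∏ i ∈ T, X i ω| ≤ ∏ i ∈ T, b i := fun ω => by
    rw [Finset.abs_prod]
    exact Finset.prod_le_prod (fun i _ => abs_nonneg _) fun i hi => hb i (hTS hi) ω
  have h := norm_integral_le_of_norm_le_const (μ := μ) (f := fun ω => ∏ i ∈ T, X i ω) (C := ∏ i ∈ T, b i)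
    (ae_of_all _ fun ω => by rw [Real.norm_eq_abs]; exact hpt ω)
  simpa [mom, Real.norm_eq_abs] using h

omit [DecidableEq ι] in
/-- Moments depend only on the slots in the index set. -/
theorem mom_congr (μ : Measure Ω) {X X' : ℕ → Ω → ℝ} {S : Finset ℕ} (h : ∀ i ∈ S, X i = X' i) :
    ∀ T ⊆ S, mom μ X T = mom μ X' T := by
  intro T hTS
  simp only [mom]
  congr 1
  funext ω
  exact Finset.prod_congr rfl fun i hi => by rw [h i (hTS hi)]

omit [DecidableEq ι] in
/-- **Order zero**: `u_1(F) = ⟨F⟩_μ`. -/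
theorem trunc_fin_zero (μ : Measure Ω) (F : Ω → ℝ) (W : P → Ω → ℝ) (q : Fin 0 → P) :
    trunc μ F W q = ∫ ω, F ω ∂μ := by
  have h : apsub (0 : ℕ) (Finset.range (0 + 1)) = ∅ := by
    ext B
    simp only [mem_apsub, Finset.notMem_empty, iff_false, zero_add, Finset.range_one]
    rintro ⟨hB, h0, hne⟩
    exact hne (Finset.Subset.antisymm hB (Finset.singleton_subset_iff.2 h0))
  rw [trunc, ac_eq, h, Finset.sum_empty, sub_zero]
  simp [mom]

end Slots

/-! ### §6 Summability over tuples from a product bound -/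

section PiSum

variable {P : Type*}

omit [DecidableEq ι] in
/-- **Product domination is summable over tuples**: if `|f q| ≤ A ∏_i g (q i)` with `g ≥ 0` and all finite sums of
`g` bounded by `Z`, then `f` is summable over `q : Fin n → P` and `Σ' |f| ≤ A Zⁿ` (finite sums over a box factor:
`Finset.prod_univ_sum`). [folklore] -/
theorem summable_pi_of_abs_le_prod [DecidableEq P] {n : ℕ} {f : (Fin n → P) → ℝ} {g : P → ℝ} {A Z : ℝ}
    (hA : 0 ≤ A) (hg : ∀ x, 0 ≤ g x) (hZ : ∀ s : Finset P, ∑ x ∈ s, g x ≤ Z)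
    (hf : ∀ q, |f q| ≤ A * ∏ i, g (q i)) :
    Summable f ∧ ∑' q, |f q| ≤ A * Z ^ n := by
  have hZ0 : 0 ≤ Z := (Finset.sum_empty (f := g)).symm.le.trans (hZ ∅)
  have hbox : ∀ S : Finset (Fin n → P), ∑ q ∈ S, A * ∏ i, g (q i) ≤ A * Z ^ n := by
    intro S
    set t : Fin n → Finset P := fun i => S.image fun q => q i with ht
    have hsub : S ⊆ Fintype.piFinset t := fun q hq =>
      Fintype.mem_piFinset.2 fun i => Finset.mem_image.2 ⟨q, hq, rfl⟩
    calc ∑ q ∈ S, A * ∏ i, g (q i) ≤ ∑ q ∈ Fintype.piFinset t, A * ∏ i, g (q i) :=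
          Finset.sum_le_sum_of_subset_of_nonneg hsub fun q _ _ =>
            mul_nonneg hA (Finset.prod_nonneg fun i _ => hg _)
      _ = A * ∏ i, ∑ x ∈ t i, g x := by rw [Finset.prod_univ_sum, Finset.mul_sum]
      _ ≤ A * ∏ _i : Fin n, Z := by
          refine mul_le_mul_of_nonneg_left ?_ hA
          exact Finset.prod_le_prod (fun i _ => Finset.sum_nonneg fun x _ => hg x) fun i _ => hZ (t i)
      _ = A * Z ^ n := by rw [Finset.prod_const, Finset.card_univ, Fintype.card_fin]
  have habs : ∀ S : Finset (Fin n → P), ∑ q ∈ S, |f q| ≤ A * Z ^ n := fun S =>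
    (Finset.sum_le_sum fun q _ => hf q).trans (hbox S)
  have hs : Summable fun q => |f q| := summable_of_sum_le (fun q => abs_nonneg _) habs
  exact ⟨hs.of_abs, Real.tsum_le_of_sum_le (fun q => abs_nonneg _) habs⟩

end PiSum

end Summit.Ventures.YMGap.Cumulants

end
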